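import Literature.NumberTheory.Sieve.BombieriFriedlanderIwaniecLemma1OffdiagFromDI11
import HarnessLib

/-!
# BFI 1986: Theorem 10 in dyadic form, Theorems 2, 5*, 5* on an interval, and the `π`-form of Theorem 10, from Deshouillers–Iwaniec's Theorem 11 at `s = 1`

Topic `Literature/NumberTheory/Sieve`.  A short addendum to `…Lemma1OffdiagFromDI11`, which derives
`BFI.K1HalfFor BFI.plateau2 (5/4)` (`BFI.k1HalfFor_of_di11`) — the `S = 1/2` instance of the
corrected Lemma 1 of E. Bombieri, J. B. Friedlander, H. Iwaniec, Acta Math. 156 (1986) / arXiv:1903.01371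
(2019), Lemma 2.1 — from Theorem 11 at `s = 1` of J.-M. Deshouillers, H. Iwaniec, Invent. Math. 70
(1982), p. 236, taken as the hypothesis `∀ g₀ (smooth, compact support in [1,2] × (0,∞)), BFI.L1.DI11For g₀`,
and records the consequences `…Theorem1/5/10_of_di11`, `bfi_wellFactorable_level_of_di11`,
`twinSieve_bfi_of_di11`.  Here are the remaining statements of the BFI cone under the same
hypothesis, each in one line through the tree's `_of_k1Half` / `_of_theorem5` / `_of_theorem10`
reductions:

* `BFI.Theorem10Dyadic_of_di11` — the dyadic form `BFI.Theorem10Dyadic` of Theorem 10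
  (`BFI.Theorem10Dyadic_of_k1Half`, `…Theorem10FromLemma1Corrected`);
* `BFI.theorem2_of_di11`, `BombieriFriedlanderIwaniecTheorem2_of_di11` — Theorem 2 (§9, p. 230)
  (`BFI.theorem2_of_k1Half`);
* `BombieriFriedlanderIwaniecTheorem5Star_of_di11`, `…Theorem5StarInterval_of_di11` — Theorem 5*
  (§13) (`…_of_theorem5`, `…Theorem5StarFromTheorem5`);
* `BombieriFriedlanderIwaniecTheorem10Pi_of_di11` — Maynard's `π`-form of Theorem 10
  (`…Theorem10Pi_of_theorem10`, `…PiForm`).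

Everything is PROVED; no definition, no named fact.  After `…Lemma1OffdiagFromDI11` and this file,
every statement of the BFI cone in the tree rests on the single hypothesis
`∀ g₀, BFI.L1.DI11For g₀` (Deshouillers–Iwaniec's Theorem 11 at `s = 1`: Kuznetsov's formula for
`Γ₀(r)` and the large sieve inequalities, §9.1 of the source).

## References

* J.-M. Deshouillers, H. Iwaniec, Invent. Math. 70 (1982), 219–288, §1.4 Theorem 11 p. 236,
  Theorem 12 p. 237, §9.2 pp. 280–282. [DeshouillersIwaniec1982]
* E. Bombieri, J. B. Friedlander, H. Iwaniec, Acta Math. 156 (1986), 203–251: Theorem 10 p. 209 and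
  §15; §9 Theorem 2 p. 230; §13 Theorem 5* p. 238. [BombieriFriedlanderIwaniecActa1986]
* E. Bombieri, J. B. Friedlander, H. Iwaniec, *Some corrections to an old paper*, arXiv:1903.01371
  (2019), §2 Lemma 2.1. [BombieriFriedlanderIwaniec2019]
-/

noncomputable section

open scoped ContDiff

namespace Literature.NumberTheory.Sieve

namespace BFI

/-- **BFI 1986, Theorem 10 in dyadic form (`BFI.Theorem10Dyadic`) from Deshouillers–Iwaniec's
Theorem 11 at `s = 1`** — through `BFI.k1HalfFor_of_di11` and `BFI.Theorem10Dyadic_of_k1Half`.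
[cite: BombieriFriedlanderIwaniecActa1986, Theorem 10 p. 209, §15; DeshouillersIwaniec1982, §1.4 Theorem 11 p. 236] -/
theorem Theorem10Dyadic_of_di11
    (h11 : ∀ g₀ : ℝ × ℝ → ℝ, ContDiff ℝ ∞ g₀ → HasCompactSupport g₀ →
      tsupport g₀ ⊆ Set.Icc (1 : ℝ) 2 ×ˢ Set.Ioi (0 : ℝ) → L1.DI11For g₀) :
    Theorem10Dyadic :=
  Theorem10Dyadic_of_k1Half (k1HalfFor_of_di11 h11)

/-- **BFI 1986, Theorem 2 (§9, p. 230) from Deshouillers–Iwaniec's Theorem 11 at `s = 1`** —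
through `BFI.k1HalfFor_of_di11` and `BFI.theorem2_of_k1Half` (Lemma 7 uses Lemma 1 at `s = 1` only).
[cite: BombieriFriedlanderIwaniecActa1986, §9 Theorem 2 p. 230; DeshouillersIwaniec1982, §1.4 Theorem 11 p. 236] -/
theorem theorem2_of_di11
    (h11 : ∀ g₀ : ℝ × ℝ → ℝ, ContDiff ℝ ∞ g₀ → HasCompactSupport g₀ →
      tsupport g₀ ⊆ Set.Icc (1 : ℝ) 2 ×ˢ Set.Ioi (0 : ℝ) → L1.DI11For g₀) :
    BombieriFriedlanderIwaniecTheorem2 :=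
  theorem2_of_k1Half (k1HalfFor_of_di11 h11)

end BFI

open BFI

section Consequences

variable (h11 : ∀ g₀ : ℝ × ℝ → ℝ, ContDiff ℝ ∞ g₀ → HasCompactSupport g₀ →
  tsupport g₀ ⊆ Set.Icc (1 : ℝ) 2 ×ˢ Set.Ioi (0 : ℝ) → BFI.L1.DI11For g₀)
include h11

/-- **BFI 1986, Theorem 2 (§9, p. 230) from Deshouillers–Iwaniec's Theorem 11 at `s = 1`**
(root-namespace form of `BFI.theorem2_of_di11`). [cite: BombieriFriedlanderIwaniecActa1986, §9 Theorem 2 p. 230] -/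
theorem BombieriFriedlanderIwaniecTheorem2_of_di11 : BombieriFriedlanderIwaniecTheorem2 :=
  BFI.theorem2_of_k1Half (BFI.k1HalfFor_of_di11 h11)

/-- **BFI 1986, Theorem 5* (§13) from Deshouillers–Iwaniec's Theorem 11 at `s = 1`** — Theorem 5*
from Theorem 5 (`…Theorem5StarFromTheorem5`) and `BombieriFriedlanderIwaniecTheorem5_of_di11`.
[cite: BombieriFriedlanderIwaniecActa1986, §13 Theorem 5* p. 238] -/
theorem BombieriFriedlanderIwaniecTheorem5Star_of_di11 : BombieriFriedlanderIwaniecTheorem5Star :=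
  BombieriFriedlanderIwaniecTheorem5Star_of_theorem5 (BombieriFriedlanderIwaniecTheorem5_of_di11 h11)

/-- **BFI 1986, Theorem 5* on an interval from Deshouillers–Iwaniec's Theorem 11 at `s = 1`.**
[cite: BombieriFriedlanderIwaniecActa1986, §13 Theorem 5* p. 238] -/
theorem BombieriFriedlanderIwaniecTheorem5StarInterval_of_di11 :
    BombieriFriedlanderIwaniecTheorem5StarInterval :=
  BombieriFriedlanderIwaniecTheorem5StarInterval_of_theorem5 (BombieriFriedlanderIwaniecTheorem5_of_di11 h11)

/-- **Maynard's `π`-form of BFI 1986, Theorem 10, from Deshouillers–Iwaniec's Theorem 11 at `s = 1`**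
— by partial summation from Theorem 10 (`BombieriFriedlanderIwaniecTheorem10Pi_of_theorem10`,
`…PiForm`). [cite: BombieriFriedlanderIwaniecActa1986, Theorem 10 p. 209] -/
theorem BombieriFriedlanderIwaniecTheorem10Pi_of_di11 : BombieriFriedlanderIwaniecTheorem10Pi :=
  BombieriFriedlanderIwaniecTheorem10Pi_of_theorem10 (BombieriFriedlanderIwaniecTheorem10_of_di11 h11)

/-- **The dyadic Theorem 10 (`BFI.Theorem10Dyadic`) from Deshouillers–Iwaniec's Theorem 11 at
`s = 1`** (root-namespace form of `BFI.Theorem10Dyadic_of_di11`). [cite: BombieriFriedlanderIwaniecActa1986, Theorem 10 p. 209, §15] -/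
theorem BFI_Theorem10Dyadic_of_di11 : BFI.Theorem10Dyadic :=
  BFI.Theorem10Dyadic_of_k1Half (BFI.k1HalfFor_of_di11 h11)

end Consequences

end Literature.NumberTheory.Sieve
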